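import Literature.Computability.Complexity.PVBridge
import Literature.Analysis.FunctionSpaces.PVSeq
import Literature.Computability.Complexity.StackWords
import HarnessLib

/-!
# Reading the tree's self-delimiting codes inside Cobham's class (strided virtual strings)

The machine level of the PCP theorem works on string numbers `sn w` (`PVBridge.lean`).  Its input is
the code of a CNF in the tree's encoding `encodingCNF` — nested `boolPair`s (`boolPair x y` doubles
the bits of `x`, then `01`, then `y` verbatim) and `listBool`s (unary length header, then the items
folded with `boolPair`).  A component of such a code is not a substring but a **strided** one: inside
`k` nested first components the bits sit `2ᵏ` apart.  This file reads such *virtual strings*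
`X[i] = w[p + s i]` arithmetically from `sn w`, inside Cobham's class:

* `tbN_def : (N.testBit i).toNat = ⌊N/2ⁱ⌋ mod 2` and `tb_sn`; `Reads w p s X` (the virtual string at `(p, s)` is `X`);
* `vEnd N p s` — the length of the first component of a pair read at `(p, s)` (first unequal bit pair,
  a bounded search), `vRest` — where its second component starts, `vVal` — the first component read
  as a binary numeral; their values on `sn w` under `Reads w p s (boolPair a y)` (`vEnd_eq`,
  `reads_fst`, `reads_snd`, `vVal_eq`) and their membership in Cobham's class (`pv_vEnd`, …);
* list bodies: `vItem N p s t` — where item `t` of a `foldr boolPair` body read at `(p, s)` starts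
  (`reads_item`: its code is read at `(vItem, 2s)`), `pv_vItem`.

## References

* S. Arora, B. Barak, *Computational Complexity: A Modern Approach*, CUP 2009, §0.1 (pairing), §1.3.
* S. R. Buss, *Bounded Arithmetic*, 1986, Ch. 1 (sharply bounded search in Cobham's class).
-/

namespace Literature.Computability.Complexity

open _root_.Computability Literature.Analysis.FunctionSpaces Finset

namespace StrNum

/-! ### More curried corollaries (a datum and two parameters) -/

section Curried3

variable {P₄ h₄ : ℕ → ℕ → ℕ → ℕ → ℕ} {St₅ : ℕ → ℕ → ℕ → ℕ → ℕ → ℕ} {K₃ S₃ M₃ B₃ Bd₃ : ℕ → ℕ → ℕ → ℕ}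

/-- `f : ℕ⁵ → ℕ` in Cobham's class. [cite: Cobham1965] -/
abbrev PV₅ (f : ℕ → ℕ → ℕ → ℕ → ℕ → ℕ) : Prop := IsPVDefinable fun v : Fin 5 → ℕ => f (v 0) (v 1) (v 2) (v 3) (v 4)

/-- Substitution into a `PV₅` function. [cite: Cobham1965] -/
theorem PV₅.comp {n : ℕ} {f : ℕ → ℕ → ℕ → ℕ → ℕ → ℕ} (hf : PV₅ f) {A B C D E : (Fin n → ℕ) → ℕ} (hA : IsPVDefinable A) (hB : IsPVDefinable B)
    (hC : IsPVDefinable C) (hD : IsPVDefinable D) (hE : IsPVDefinable E) : IsPVDefinable fun x => f (A x) (B x) (C x) (D x) (E x) :=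
  hf.compVec (w := fun x => ![A x, B x, C x, D x, E x]) fun i => by fin_cases i <;> simpa

/-- Curried loop, a datum and two parameters. [cite: Cobham1965] -/
theorem PV₃.loopNat (hB : PV₃ B₃) (hSt : PV₅ St₅) (hK : PV₃ K₃) (hS : PV₃ S₃) (hKS : ∀ a p q, K₃ a p q ≤ (S₃ a p q).size) (hBd : PV₃ Bd₃)
    (hle : ∀ a p q, ∀ i ≤ K₃ a p q, loopNat (B₃ a p q) (St₅ a p q) i ≤ Bd₃ a p q) :
    PV₃ fun a p q => loopNat (B₃ a p q) (St₅ a p q) (K₃ a p q) :=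
  IsPVDefinable.of_loopNat (n := 3) (B := fun x => B₃ (x 0) (x 1) (x 2)) (St := fun x => St₅ (x 0) (x 1) (x 2)) (K := fun x => K₃ (x 0) (x 1) (x 2))
    (S := fun x => S₃ (x 0) (x 1) (x 2)) (Bd := fun x => Bd₃ (x 0) (x 1) (x 2)) hB
    (hSt.comp (IsPVDefinable.proj 0) (IsPVDefinable.proj 1) (IsPVDefinable.proj 2) (IsPVDefinable.proj 3) (IsPVDefinable.proj 4)) hK hS
    (fun _ => hKS _ _ _) hBd fun _ => hle _ _ _

/-- Curried bounded sum, a datum and two parameters. [cite: Buss1986, Ch. 1] -/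
theorem PV₃.sumBelow (hh : PV₄ h₄) (hK : PV₃ K₃) (hS : PV₃ S₃) (hKS : ∀ a p q, K₃ a p q ≤ (S₃ a p q).size) (hM : PV₃ M₃)
    (hle : ∀ a p q, ∀ i < K₃ a p q, h₄ a p q i ≤ M₃ a p q) : PV₃ fun a p q => sumBelow (h₄ a p q) (K₃ a p q) :=
  IsPVDefinable.of_sumBelow (n := 3) (h := fun x => h₄ (x 0) (x 1) (x 2)) (K := fun x => K₃ (x 0) (x 1) (x 2)) (S := fun x => S₃ (x 0) (x 1) (x 2))
    (M := fun x => M₃ (x 0) (x 1) (x 2)) (hh.comp (IsPVDefinable.proj 0) (IsPVDefinable.proj 1) (IsPVDefinable.proj 2) (IsPVDefinable.proj 3))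
    hK hS (fun _ => hKS _ _ _) hM fun _ => hle _ _ _

/-- Curried bounded search, a datum and two parameters. [cite: Buss1986, Ch. 1] -/
theorem PV₃.muNat (hP : PV₄ P₄) (hK : PV₃ K₃) (hS : PV₃ S₃) (hKS : ∀ a p q, K₃ a p q ≤ (S₃ a p q).size) :
    PV₃ fun a p q => muNat (P₄ a p q) (K₃ a p q) :=
  IsPVDefinable.of_muNat (n := 3) (P := fun x => P₄ (x 0) (x 1) (x 2)) (K := fun x => K₃ (x 0) (x 1) (x 2)) (S := fun x => S₃ (x 0) (x 1) (x 2))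
    (hP.comp (IsPVDefinable.proj 0) (IsPVDefinable.proj 1) (IsPVDefinable.proj 2) (IsPVDefinable.proj 3)) hK hS fun _ => hKS _ _ _

end Curried3

/-! ### Bits of string numbers -/

/-- Bit `i` of `N` as a number, `(N.testBit i).toNat`, is `⌊N / 2ⁱ⌋ mod 2`. [folklore] -/
theorem tbN_def (N i : ℕ) : (Nat.testBit N i).toNat = N / 2 ^ i % 2 := by
  rw [Nat.testBit_eq_decide_div_mod_eq]
  rcases Nat.mod_two_eq_zero_or_one (N / 2 ^ i) with h | h <;> rw [h] <;> simp

/-- `(N, i) ↦ (N.testBit i).toNat` is in Cobham's class. [cite: Buss1986, §2.4] -/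
theorem pv_tb : PV₂ fun N i => (Nat.testBit N i).toNat :=
  ((IsPVDefinable.proj 0).testBit (IsPVDefinable.proj 1)).of_eq fun v => (tbN_def (v 0) (v 1)).symm

/-- Bits of a `bitsToNat`, as numbers. [folklore] -/
theorem tb_bitsToNat (u : List Bool) (i : ℕ) : (Nat.testBit (bitsToNat u) i).toNat = (u.getD i false).toNat := by
  rw [testBit_bitsToNat_eq_getD]

/-- **Bits of a string number**: `(Nat.testBit (sn w) i).toNat = w[i]` inside `w`. [folklore] -/
theorem tb_sn {w : List Bool} {i : ℕ} (hi : i < w.length) : (Nat.testBit (sn w) i).toNat = (w[i]).toNat := by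
  unfold sn; rw [tb_bitsToNat, List.getD_eq_getElem?_getD, List.getElem?_append_left hi, List.getElem?_eq_getElem hi]; rfl

/-- The marker bit. [folklore] -/
theorem tb_sn_length (w : List Bool) : (Nat.testBit (sn w) w.length).toNat = 1 := by
  unfold sn; rw [tb_bitsToNat, List.getD_eq_getElem?_getD, List.getElem?_append_right le_rfl]; simp

/-! ### Virtual strings -/

/-- `Reads w p s X`: the virtual string of `w` at start `p` and stride `s` begins with `X`. [folklore] -/
def Reads (w : List Bool) (p s : ℕ) (X : List Bool) : Prop := ∀ i (hi : i < X.length), ∃ h : p + s * i < w.length, w[p + s * i] = X[i]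

/-- The whole string reads itself. [folklore] -/
theorem reads_self (w : List Bool) : Reads w 0 1 w := fun i hi => ⟨by simpa using hi, by simp⟩

/-- A prefix of what is read is read. [folklore] -/
theorem Reads.prefix {w : List Bool} {p s : ℕ} {X Y : List Bool} (h : Reads w p s (X ++ Y)) : Reads w p s X := fun i hi => by
  obtain ⟨h1, h2⟩ := h i (by rw [List.length_append]; omega)
  exact ⟨h1, by rw [h2, List.getElem_append_left hi]⟩

/-- What follows a read prefix is read further on. [folklore] -/
theorem Reads.suffix {w : List Bool} {p s : ℕ} {X Y : List Bool} (h : Reads w p s (X ++ Y)) : Reads w (p + s * X.length) s Y := fun i hi => by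
  obtain ⟨h1, h2⟩ := h (X.length + i) (by rw [List.length_append]; omega)
  have e : p + s * X.length + s * i = p + s * (X.length + i) := by ring
  refine ⟨by rw [e]; exact h1, ?_⟩
  simp only [e]
  rw [h2, List.getElem_append_right (by omega)]
  congr 1; omega

/-- The virtual bit `i` at `(p, s)`. [folklore] -/
def vbit (N p s i : ℕ) : ℕ := (Nat.testBit N (p + s * i)).toNat

/-- `vbit` is in Cobham's class. [cite: Buss1986, §2.4] -/
theorem pv_vbit : PV₄ vbit :=
  pv_tb.comp (IsPVDefinable.proj 0) (((IsPVDefinable.proj 1)).add ((IsPVDefinable.proj 2).mul (IsPVDefinable.proj 3)))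

/-- Virtual bits under `Reads`. [folklore] -/
theorem vbit_eq {w : List Bool} {p s : ℕ} {X : List Bool} (h : Reads w p s X) {i : ℕ} (hi : i < X.length) : vbit (sn w) p s i = (X[i]).toNat := by
  obtain ⟨h1, h2⟩ := h i hi
  unfold vbit; rw [tb_sn h1, h2]

/-- Bits of a pair: the doubled part. [folklore] -/
theorem getElem_boolPair_dup : ∀ {a y : List Bool} {i : ℕ} (hi : i < 2 * a.length),
    (boolPair a y)[i]'(by rw [length_boolPair]; omega) = a[i / 2]'(by omega)
  | [], _, i, hi => absurd hi (by simp)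
  | b :: a, y, 0, _ => by simp [boolPair]
  | b :: a, y, 1, _ => by simp [boolPair]
  | b :: a, y, i + 2, hi => by
    simp only [show boolPair (b :: a) y = b :: b :: boolPair a y by simp [boolPair], List.getElem_cons_succ, show (i + 2) / 2 = i / 2 + 1 by omega]
    exact getElem_boolPair_dup (by simp at hi; omega)

/-- Bits of a pair: the separator `0`. [folklore] -/
theorem getElem_boolPair_sep0 : ∀ (a y : List Bool), (boolPair a y)[2 * a.length]'(by rw [length_boolPair]; omega) = false
  | [], y => by simp [boolPair]
  | b :: a, y => by
    simp only [show boolPair (b :: a) y = b :: b :: boolPair a y by simp [boolPair], List.length_cons, show 2 * (a.length + 1) = 2 * a.length + 1 + 1 by ring, List.getElem_cons_succ]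
    exact getElem_boolPair_sep0 a y

/-- Bits of a pair: the separator `1`. [folklore] -/
theorem getElem_boolPair_sep1 : ∀ (a y : List Bool), (boolPair a y)[2 * a.length + 1]'(by rw [length_boolPair]; omega) = true
  | [], y => by simp [boolPair]
  | b :: a, y => by
    simp only [show boolPair (b :: a) y = b :: b :: boolPair a y by simp [boolPair], List.length_cons, show 2 * (a.length + 1) + 1 = 2 * a.length + 1 + 1 + 1 by ring, List.getElem_cons_succ]
    exact getElem_boolPair_sep1 a y

/-- A pair is its doubled part and separator followed by the second component. [folklore] -/
theorem boolPair_eq_append (a y : List Bool) : boolPair a y = ((a.flatMap fun b => [b, b]) ++ [false, true]) ++ y := by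
  simp [boolPair]

/-- **Reading the first component** of a pair read at `(p, s)`: it is read at `(p, 2s)`. [folklore] -/
theorem reads_fst {w : List Bool} {p s : ℕ} {a y : List Bool} (h : Reads w p s (boolPair a y)) : Reads w p (2 * s) a := fun i hi => by
  obtain ⟨h1, h2⟩ := h (2 * i) (by rw [length_boolPair]; omega)
  refine ⟨by rw [mul_comm 2 s, mul_assoc]; exact h1, ?_⟩
  have e : p + 2 * s * i = p + s * (2 * i) := by ring
  simp only [e]
  rw [h2, getElem_boolPair_dup (by omega)]
  congr 1; omega

/-- **Reading the second component**: it is read at `(p + s (2|a| + 2), s)`. [folklore] -/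
theorem reads_snd {w : List Bool} {p s : ℕ} {a y : List Bool} (h : Reads w p s (boolPair a y)) : Reads w (p + s * (2 * a.length + 2)) s y := by
  rw [boolPair_eq_append] at h
  have hl : ((a.flatMap fun b => [b, b]) ++ [false, true]).length = 2 * a.length + 2 := by
    have := length_boolPair a []
    rw [boolPair_eq_append, List.append_nil] at this
    simpa using this
  have := h.suffix
  rwa [hl] at this

/-! ### The end of the first component -/

/-- The length of the first component of the pair read at `(p, s)`: the first `j` with unequal bits
`X[2j] ≠ X[2j+1]`, searched below `|N|`. [folklore] -/
def vEnd (N p s : ℕ) : ℕ := muNat (fun j => if vbit N p s (2 * j) = vbit N p s (2 * j + 1) then 0 else 1) N.size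

/-- `vEnd ≤ |N|`. [folklore] -/
theorem vEnd_le (N p s : ℕ) : vEnd N p s ≤ N.size := muNat_le _ _

/-- `vEnd` is in Cobham's class. [cite: Buss1986, Ch. 1] -/
theorem pv_vEnd : PV₃ vEnd := by
  have hP : PV₄ fun N p s j => if vbit N p s (2 * j) = vbit N p s (2 * j + 1) then 0 else 1 := by
    have h0 : IsPVDefinable fun v : Fin 4 → ℕ => vbit (v 0) (v 1) (v 2) (2 * v 3) :=
      pv_vbit.comp (IsPVDefinable.proj 0) (IsPVDefinable.proj 1) (IsPVDefinable.proj 2) ((IsPVDefinable.const 2).mul (IsPVDefinable.proj 3))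
    have h1 : IsPVDefinable fun v : Fin 4 → ℕ => vbit (v 0) (v 1) (v 2) (2 * v 3 + 1) :=
      pv_vbit.comp (IsPVDefinable.proj 0) (IsPVDefinable.proj 1) (IsPVDefinable.proj 2) ((IsPVDefinable.const 2).mul (IsPVDefinable.proj 3)).succ
    exact h0.ite_eq h1 (IsPVDefinable.const 0) (IsPVDefinable.const 1)
  exact PV₃.muNat (K₃ := fun N _ _ => N.size) (S₃ := fun N _ _ => N) hP (IsPVDefinable.proj 0).len (IsPVDefinable.proj 0) fun _ _ _ => le_rfl

/-- **The value of `vEnd` on a pair**: `|a|` (strides `s > 0`). [folklore] -/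
theorem vEnd_eq {w : List Bool} {p s : ℕ} {a y : List Bool} (hs : 0 < s) (h : Reads w p s (boolPair a y)) : vEnd (sn w) p s = a.length := by
  unfold vEnd
  have hlen : a.length ≤ (sn w).size := by
    rw [size_sn]
    obtain ⟨h1, -⟩ := h (2 * a.length + 1) (by rw [length_boolPair]; omega)
    have := Nat.le_mul_of_pos_left (2 * a.length + 1) hs
    omega
  refine muNat_eq_of hlen (fun j hj => ?_) (fun _ => ?_)
  · rw [vbit_eq h (by rw [length_boolPair]; omega), vbit_eq h (by rw [length_boolPair]; omega),
      getElem_boolPair_dup (by omega), getElem_boolPair_dup (by omega)]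
    simp [show (2 * j + 1) / 2 = j by omega]
  · rw [vbit_eq h (by rw [length_boolPair]; omega), vbit_eq h (by rw [length_boolPair]; omega), getElem_boolPair_sep0, getElem_boolPair_sep1]
    simp

/-- Where the second component starts. [folklore] -/
def vRest (N p s : ℕ) : ℕ := p + s * (2 * vEnd N p s + 2)

/-- `vRest` is in Cobham's class. [cite: Buss1986, Ch. 1] -/
theorem pv_vRest : PV₃ vRest :=
  (IsPVDefinable.proj 1).add ((IsPVDefinable.proj 2).mul (((IsPVDefinable.const 2).mul
    (pv_vEnd.comp (IsPVDefinable.proj 0) (IsPVDefinable.proj 1) (IsPVDefinable.proj 2))).add (IsPVDefinable.const 2)))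

/-- **The second component is read at `(vRest, s)`.** [folklore] -/
theorem reads_vRest {w : List Bool} {p s : ℕ} {a y : List Bool} (hs : 0 < s) (h : Reads w p s (boolPair a y)) : Reads w (vRest (sn w) p s) s y := by
  unfold vRest; rw [vEnd_eq hs h]; exact reads_snd h

/-- `vRest` moves forward by at least `2s`. [folklore] -/
theorem le_vRest (N p s : ℕ) : p + 2 * s ≤ vRest N p s := by unfold vRest; nlinarith

/-- `vRest ≤ p + s (2|N| + 2)`. [folklore] -/
theorem vRest_le (N p s : ℕ) : vRest N p s ≤ p + s * (2 * N.size + 2) := by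
  unfold vRest; exact Nat.add_le_add_left (Nat.mul_le_mul_left _ (by have := vEnd_le N p s; omega)) _

/-- The first component read as a binary numeral (least significant bit first). [folklore] -/
def vVal (N p s : ℕ) : ℕ := sumBelow (fun i => vbit N p s (2 * i) * 2 ^ i) (vEnd N p s)

/-- Sums with summands agreeing below the bound agree. [folklore] -/
theorem sumBelow_congr {f g : ℕ → ℕ} {k : ℕ} (h : ∀ i < k, f i = g i) : sumBelow f k = sumBelow g k :=
  Finset.sum_congr rfl fun i hi => h i (Finset.mem_range.1 hi)

/-- `vVal` is in Cobham's class. [cite: Buss1986, Ch. 1] -/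
theorem pv_vVal : PV₃ vVal := by
  -- with the power guarded as `2^{min i |N|}` (agrees below the summation bound `vEnd ≤ |N|`)
  have hh : PV₄ fun N p s i => vbit N p s (2 * i) * 2 ^ min i N.size := by
    have h0 : IsPVDefinable fun v : Fin 4 → ℕ => vbit (v 0) (v 1) (v 2) (2 * v 3) :=
      pv_vbit.comp (IsPVDefinable.proj 0) (IsPVDefinable.proj 1) (IsPVDefinable.proj 2) ((IsPVDefinable.const 2).mul (IsPVDefinable.proj 3))
    exact h0.mul ((IsPVDefinable.const 2).powLen (IsPVDefinable.proj 3) (IsPVDefinable.proj 0))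
  have h := PV₃.sumBelow (K₃ := vEnd) (S₃ := fun N _ _ => N) (M₃ := fun N _ _ => 2 ^ N.size) hh pv_vEnd (IsPVDefinable.proj 0)
    (fun N p s => vEnd_le N p s) ((IsPVDefinable.proj 0).pow_len) fun N p s i _ => by
      calc vbit N p s (2 * i) * 2 ^ min i N.size ≤ 1 * 2 ^ N.size :=
            Nat.mul_le_mul (Bool.toNat_le _) (Nat.pow_le_pow_right two_pos (min_le_right _ _))
        _ = 2 ^ N.size := one_mul _
  refine h.of_eq fun N p s => sumBelow_congr fun i hi => ?_
  rw [min_eq_left (hi.le.trans (vEnd_le N p s))]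

/-- Value of a `sumBelow` of bits: `bitsToNat`. [folklore] -/
theorem sumBelow_bits (a : List Bool) : sumBelow (fun i => (a.getD i false).toNat * 2 ^ i) a.length = bitsToNat a := by
  induction a using List.reverseRecOn with
  | nil => rfl
  | append_singleton a b ih =>
    rw [List.length_append, List.length_singleton, sumBelow, Finset.sum_range_succ, ← sumBelow, bitsToNat_append]
    rw [sumBelow_congr (g := fun i => (a.getD i false).toNat * 2 ^ i) fun i hi => by
      rw [List.getD_eq_getElem?_getD, List.getElem?_append_left hi, ← List.getD_eq_getElem?_getD]]
    rw [ih, List.getD_eq_getElem?_getD, List.getElem?_append_right le_rfl]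
    cases b <;> simp [bitsToNat]

/-- **The value of `vVal` on a pair**: the numeral value of the first component. [folklore] -/
theorem vVal_eq {w : List Bool} {p s : ℕ} {a y : List Bool} (hs : 0 < s) (h : Reads w p s (boolPair a y)) : vVal (sn w) p s = bitsToNat a := by
  unfold vVal
  rw [vEnd_eq hs h, ← sumBelow_bits]
  refine sumBelow_congr fun i hi => ?_
  rw [vbit_eq h (by rw [length_boolPair]; omega), getElem_boolPair_dup (by omega)]
  simp only [show 2 * i / 2 = i by omega]
  rw [List.getD_eq_getElem?_getD, List.getElem?_eq_getElem hi]; rfl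

/-- `vVal` of a numeral component: the number. [folklore] -/
theorem vVal_encodeNat {w : List Bool} {p s : ℕ} {v : ℕ} {y : List Bool} (hs : 0 < s) (h : Reads w p s (boolPair (encodeNat v) y)) :
    vVal (sn w) p s = v := by
  rw [vVal_eq hs h]; exact bitsToNat_encodeNat v

/-! ### List bodies -/

/-- The start of item `t` of a `foldr boolPair` list body read at `(p, s)`. [folklore] -/
def vItem (N p s t : ℕ) : ℕ := loopNat p (fun _ q => vRest N q s) t

/-- `vItem` at `0`. [folklore] -/
theorem vItem_zero (N p s : ℕ) : vItem N p s 0 = p := rfl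

/-- `vItem` at `t + 1`. [folklore] -/
theorem vItem_succ (N p s t : ℕ) : vItem N p s (t + 1) = vRest N (vItem N p s t) s := rfl

/-- Items move forward by a bounded amount: `vItem t ≤ p + t s (2|N| + 2)`. [folklore] -/
theorem vItem_le (N p s t : ℕ) : vItem N p s t ≤ p + t * (s * (2 * N.size + 2)) := by
  induction t with
  | zero => simp [vItem_zero]
  | succ t ih => rw [vItem_succ]; have := vRest_le N (vItem N p s t) s; nlinarith

/-- The list body of the codes `c t, c (t+1), …` (`k` of them), folded with `boolPair`. [folklore] -/
def body (c : ℕ → List Bool) : ℕ → ℕ → List Bool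
  | _, 0 => []
  | t, k + 1 => boolPair (c t) (body c (t + 1) k)

/-- `foldr boolPair` over a list is a `body`. [folklore] -/
theorem foldr_eq_body (L : List (List Bool)) (t : ℕ) :
    (L.drop t).foldr (fun a acc => boolPair a acc) [] = body (fun i => L.getD i []) t (L.length - t) := by
  induction hk : L.length - t generalizing t with
  | zero => rw [List.drop_eq_nil_of_le (by omega)]; rfl
  | succ k ih =>
    rw [List.drop_eq_getElem_cons (by omega), List.foldr_cons, body, ih (t + 1) (by omega)]
    congr 1
    rw [List.getD_eq_getElem?_getD, List.getElem?_eq_getElem (by omega)]; rfl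

/-- **Reading item `t`** of a body read at `(p, s)`: the rest of the body from item `t` is read at
`(vItem t, s)`. [folklore] -/
theorem reads_item {w : List Bool} {p s : ℕ} {c : ℕ → List Bool} {t₀ k : ℕ} (hs : 0 < s) (h : Reads w p s (body c t₀ k)) :
    ∀ t ≤ k, Reads w (vItem (sn w) p s t) s (body c (t₀ + t) (k - t)) := by
  intro t ht
  induction t with
  | zero => simpa [vItem_zero] using h
  | succ t ih =>
    have h1 := ih (Nat.le_of_succ_le ht)
    obtain ⟨k', hk'⟩ : ∃ k', k - t = k' + 1 := ⟨k - t - 1, by omega⟩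
    rw [hk', body] at h1
    rw [vItem_succ, show t₀ + (t + 1) = t₀ + t + 1 by ring, show k - (t + 1) = k' by omega]
    exact reads_vRest hs h1

/-- The code of item `t < k` is read at `(vItem t, 2s)`. [folklore] -/
theorem reads_item_code {w : List Bool} {p s : ℕ} {c : ℕ → List Bool} {k : ℕ} (hs : 0 < s) (h : Reads w p s (body c 0 k)) {t : ℕ} (ht : t < k) :
    Reads w (vItem (sn w) p s t) (2 * s) (c t) := by
  have h1 := reads_item hs h t ht.le
  obtain ⟨k', hk'⟩ : ∃ k', k - t = k' + 1 := ⟨k - t - 1, by omega⟩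
  rw [hk', body, zero_add] at h1
  exact reads_fst h1

/-- `vItem` is in Cobham's class, with the item number clocked by `|N|` (`min t |N|`, which is all that
is used). [cite: Buss1986, Ch. 1] -/
theorem pv_vItem : PV₄ fun N p s t => vItem N p s (min t N.size) :=
  IsPVDefinable.of_loopNat (n := 4) (B := fun x => x 1) (St := fun x _ q => vRest (x 0) q (x 2)) (K := fun x => min (x 3) (x 0).size)
    (S := fun x => x 0) (Bd := fun x => x 1 + (x 0).size * (x 2 * (2 * (x 0).size + 2))) (IsPVDefinable.proj 1)
    (pv_vRest.comp (IsPVDefinable.proj 0) (IsPVDefinable.proj 5) (IsPVDefinable.proj 2))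
    ((IsPVDefinable.proj 3).inf (IsPVDefinable.proj 0).len) (IsPVDefinable.proj 0) (fun _ => min_le_right _ _)
    ((IsPVDefinable.proj 1).add ((IsPVDefinable.proj 0).len.mul ((IsPVDefinable.proj 2).mul
      (((IsPVDefinable.const 2).mul (IsPVDefinable.proj 0).len).add (IsPVDefinable.const 2)))))
    fun x i hi => (vItem_le (x 0) (x 1) (x 2) i).trans (Nat.add_le_add_left (Nat.mul_le_mul_right _ (hi.trans (min_le_right _ _))) _)

end StrNum

end Literature.Computability.Complexity
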